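import Literature.NumberTheory.GaloisRepresentations.ContinuousShapiroOpenCoinduced
import Literature.NumberTheory.GaloisRepresentations.ContinuousCohomologySESFiniteness
import Literature.NumberTheory.GaloisRepresentations.PPrimaryDevissage
import HarnessLib

/-!
# Finiteness of `H²(G, M)` for finite `p`-primary coefficients by dévissage through the coinduced
# module (Neukirch–Schmidt–Wingberg (8.3.20), proof; Milne ADT I Lemma 4.14 / proof of Thm. 1.8)

Topic `NumberTheory/GaloisRepresentations` (continuous cochain cohomology); namespace
`Literature.NumberTheory.GaloisRepresentations` (dot notation under `ContinuousRep`).  Definitions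
with bodies (the quotient `Maps(G ⧸ U, M) ⧸ M` and its projection) and theorems; no named fact, no
`sorry`, no instance, no notation.

Let `G` be a profinite group (compact, Hausdorff, totally disconnected), `p` a prime and
`ρ₀ : G → Aut(L)` a continuous action on a discrete group `L` of order `p` (in the application:
`G = G_{K,S}`, `L = μ_p`).  NSW (8.3.20) ("Let `S` be a finite set of primes … Then the groups
`Hⁿ(G_S, A)` are finite for every finite `G_S`-module `A` with `#A ∈ ℕ(S)`") is proved there from
the case `A = μ_p` over the open subgroups ("we may assume `μ_p ⊂ k` … `A` trivial …") by the
standard dévissage; Milne (*ADT* I, proof of Thm. 1.8 and Lemma 4.14) embeds a general `M` in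
`M_* = Hom(ℤ[G/U], M)` for an open normal `U` acting trivially.  This file formalises exactly that
reduction for DEGREE `2`, in the currency of the tree's `IsSES` / `continuousCohomology`:

* §1 the short exact sequence **`0 → M → Maps(G ⧸ U, M) → Q → 0`** (`isSES_coindOpen`; the unit
  `coindOpenUnit` of `ContinuousShapiroOpenCoinduced`, the quotient `coindOpenQuot`, its projection
  `coindOpenπ`; `Q` finite, `p`-primary) and the openness of the kernel of the action on a finite
  discrete module (`isOpen_ker_of_finite`);
* §2 `Nat.card`/`Finite` transport between two TRIVIAL modules of the same prime order
  (`nonempty_continuousCohomology_addEquiv_of_trivial_of_card_eq`);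
* §3 **trivial coefficients** (`finite_continuousCohomology_two_of_trivial`): if `L` is trivial of
  order `p` with `H²(G, L)` finite, then `H²(G, W)` is finite for every finite trivial `p`-primary `W`
  (induction on `#W` through a line `ℤ/p ≅ L`, `IsSES.finite_two_X₂`);
* §4 **THE DÉVISSAGE** (`finite_continuousCohomology_two_of_isPrimaryTorsion`): if `H¹(G, N)` is
  finite for every finite discrete `p`-primary `N` (at `G_{K,S}`, `S` finite: Hermite, the tree's
  `ContinuousRep.finite_continuousCohomology_one`) and `H²(U, L)` is finite for every OPEN `U ≤ G`
  fixing `L` pointwise (at `G_{K,S}`: Kummer theory on the `S`-units, lane brick B1a), then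
  **`H²(G, M)` is finite for every finite discrete `p`-primary `G`-module `M`**: by induction on
  `#M`, through `0 → M[p] → M → M/M[p] → 0` (`IsSES.finite_two_X₂`) when `pM ≠ 0`, and, when
  `pM = 0`, through `0 → M → Maps(G ⧸ U, M) → Q → 0` with `U = ker ρ ∩ ker ρ₀` (`IsSES.finite_two_X₁`:
  `H¹(G, Q)` finite by hypothesis, `H²(G, Maps(G ⧸ U, M)) ≅ H²(U, M)` by Shapiro
  (`finite_continuousCohomology_coindOpen_iff`), and over `U` the module `M` is trivial, §3).

Lane «TATE-EPC-TC» of cell `bsd-eis` (crux `GoodLatticeBDPValue`, stmt-BirchSwinnertonDyer-19032),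
brick B1b ("B2 = B1b" of ROUTING #5): the `G_{K,S}` reading (`Finite (restrictedCohomology ρ S 2)`
for every number field, NSW (8.3.20) `r = 2`) is the sequel file.  HONEST FRAMING: homological
algebra of profinite groups only; no arithmetic statement and no case of BSD is proved here.

## References
* J. Neukirch, A. Schmidt, K. Wingberg, *Cohomology of Number Fields*, 2nd ed. (2008), (8.3.20)
  and its proof; I §6 (induced modules). [NeukirchSchmidtWingberg2008]
* J. S. Milne, *Arithmetic Duality Theorems*, 2nd ed. (2006), I §1 (proof of Thm. 1.8), I Lemma 4.14,
  I Cor. 4.15. [MilneADT2006]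
* J.-P. Serre, *Cohomologie galoisienne* (1994), I §2.2, I §2.5, II §3.1 (dévissage to `ℤ/p`).
  [SerreGaloisCohomology1997]
-/

noncomputable section

open CategoryTheory Function
open scoped Topology

universe u

namespace Literature.NumberTheory.GaloisRepresentations

open _root_.TopRep _root_.ContRepresentation _root_.ContinuousCohomology

/-! ## §1 The short exact sequence `0 → M → Maps(G ⧸ U, M) → Q → 0` -/

namespace ContinuousRep

section SES

variable {G : Type u} [Group G] [TopologicalSpace G] [IsTopologicalGroup G] [CompactSpace G]
variable {M : Type u} [AddCommGroup M] [TopologicalSpace M] [DiscreteTopology M]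
  (ρ : ContinuousRep G ℤ M) (U : Subgroup G) (hU : IsOpen (U : Set G))

omit [IsTopologicalGroup G] [CompactSpace G] in
/-- The kernel of a continuous action on a FINITE discrete module is open (a finite intersection of
open stabilisers). [cite: SerreGaloisCohomology1997, I §2.1] -/
theorem isOpen_ker_of_finite [Finite M] : IsOpen (ρ.ker : Set G) := by
  have h : (ρ.ker : Set G) = ⋂ m : M, {g | ρ g m = m} := by
    ext g
    simp only [SetLike.mem_coe, ContinuousRep.mem_ker, Set.mem_iInter, Set.mem_setOf_eq,
      LinearMap.ext_iff, LinearMap.id_apply]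
  rw [h]
  exact isOpen_iInter_of_finite fun m => ρ.isOpen_setOf_apply_eq m

omit [IsTopologicalGroup G] [CompactSpace G] [DiscreteTopology M] in
/-- Elements of the kernel act trivially. [cite: SerreGaloisCohomology1997, I §2.1] -/
theorem apply_eq_self_of_mem_ker {g : G} (hg : g ∈ ρ.ker) (m : M) : ρ g m = m := by
  rw [(ρ.mem_ker g).1 hg, LinearMap.id_apply]

/-- The constant functions `M ⊆ Maps(G ⧸ U, M)` (the image of the unit `coindOpenUnit`).
[cite: MilneADT2006, I §1 (proof of Thm. 1.8)] -/
def coindOpenConst : Submodule ℤ (G ⧸ U → M) :=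
  LinearMap.range (ρ.coindOpenUnit U hU).hom.toContinuousLinearMap.toLinearMap

/-- Membership in `coindOpenConst`: being a constant function. [cite: MilneADT2006, I §1 (proof of Thm. 1.8)] -/
theorem mem_coindOpenConst_iff (φ : G ⧸ U → M) :
    φ ∈ ρ.coindOpenConst U hU ↔ ∃ m : M, (fun _ => m) = φ := Iff.rfl

/-- The constants are stable under the action of `Maps(G ⧸ U, M)` (`g ⋆ const m = const (g m)`).
[cite: NeukirchSchmidtWingberg2008, I §6 (induced modules)] -/
theorem coindOpenConst_le_comap (g : G) :
    ρ.coindOpenConst U hU ≤ (ρ.coindOpenConst U hU).comap (ρ.coindOpen U hU g) := by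
  rintro _ ⟨m, rfl⟩
  exact ⟨ρ g m, rfl⟩

/-- **The quotient `Q = Maps(G ⧸ U, M) ⧸ M`** as a continuous representation on a discrete module
(Milne's `M₁` in `0 → M → M_* → M₁ → 0`). [cite: MilneADT2006, I §1 (proof of Thm. 1.8)] -/
def coindOpenQuot : ContinuousRep G ℤ ((G ⧸ U → M) ⧸ ρ.coindOpenConst U hU) :=
  haveI : DiscreteTopology (G ⧸ U → M) := discreteTopology_coindOpen U hU
  (ρ.coindOpen U hU).quotient (ρ.coindOpenConst U hU) (ρ.coindOpenConst_le_comap U hU)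

/-- Unfolding `coindOpenQuot` on classes. [cite: MilneADT2006, I §1 (proof of Thm. 1.8)] -/
@[simp] theorem coindOpenQuot_apply_mk (g : G) (φ : G ⧸ U → M) :
    ρ.coindOpenQuot U hU g (Submodule.Quotient.mk φ) = Submodule.Quotient.mk (ρ.coindOpen U hU g φ) :=
  rfl

/-- The projection `Maps(G ⧸ U, M) ⟶ Q`. [cite: MilneADT2006, I §1 (proof of Thm. 1.8)] -/
def coindOpenπ : (ρ.coindOpen U hU).toTopRep ⟶ (ρ.coindOpenQuot U hU).toTopRep :=
  haveI : DiscreteTopology (G ⧸ U → M) := discreteTopology_coindOpen U hU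
  (ρ.coindOpen U hU).mkQHom (ρ.coindOpenConst U hU) (ρ.coindOpenConst_le_comap U hU)

/-- `coindOpenπ` is the quotient map on elements. [cite: MilneADT2006, I §1 (proof of Thm. 1.8)] -/
@[simp] theorem coindOpenπ_hom_apply (φ : G ⧸ U → M) :
    (ρ.coindOpenπ U hU).hom φ = Submodule.Quotient.mk φ := rfl

/-- **`0 → M → Maps(G ⧸ U, M) → Q → 0` is a short exact sequence of discrete `G`-modules** (the
instance `DiscreteTopology (G ⧸ U → M)` is `discreteTopology_coindOpen U hU`).
[cite: MilneADT2006, I §1 (proof of Thm. 1.8) and I Lemma 4.14] -/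
theorem isSES_coindOpen [DiscreteTopology (G ⧸ U → M)] :
    IsSES (ρ.coindOpenUnit U hU) (ρ.coindOpenπ U hU) where
  comp_eq_zero := by
    ext m
    change Submodule.Quotient.mk (p := ρ.coindOpenConst U hU) ((ρ.coindOpenUnit U hU).hom m) = 0
    exact (Submodule.Quotient.mk_eq_zero _).2 ⟨m, rfl⟩
  injective := ρ.coindOpenUnit_injective U hU
  exact_mid := fun φ hφ => by
    change Submodule.Quotient.mk (p := ρ.coindOpenConst U hU) φ = 0 at hφ
    exact (Submodule.Quotient.mk_eq_zero _).1 hφ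
  surjective := Submodule.Quotient.mk_surjective _

include hU in
/-- `Q` is finite when `M` is. [cite: MilneADT2006, I §1 (proof of Thm. 1.8)] -/
theorem finite_coindOpenQuot [Finite M] : Finite ((G ⧸ U → M) ⧸ ρ.coindOpenConst U hU) :=
  haveI : Finite (G ⧸ U → M) := finite_coindOpen U hU
  Finite.of_surjective _ (Submodule.Quotient.mk_surjective _)

include hU in
/-- `Q` is `p`-primary when `M` is. [cite: SerreGaloisCohomology1997, II §3.1] -/
theorem isPrimaryTorsion_coindOpenQuot {p : ℕ} (hM : IsPrimaryTorsion p M) :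
    IsPrimaryTorsion p ((G ⧸ U → M) ⧸ ρ.coindOpenConst U hU) :=
  (isPrimaryTorsion_coindOpen U hU hM).quotient _

end SES

/-! ## §2 Transport between trivial modules of the same prime order -/

section Transport

variable {G : Type u} [Group G] [TopologicalSpace G] [IsTopologicalGroup G]

/-- **Isomorphic trivial modules of prime order have isomorphic cohomology**: two finite discrete
`G`-modules of the same prime order with trivial action are equivariantly isomorphic (both are
`ℤ/p`, `zmodAddCyclicAddEquiv`), so `Hⁿ(G, A₁) ≃+ Hⁿ(G, A₂)` (`continuousCohomologyAddEquiv`).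
[cite: SerreGaloisCohomology1997, I §2.2] -/
theorem nonempty_continuousCohomology_addEquiv_of_trivial_of_card_eq {A₁ : Type u} [AddCommGroup A₁]
    [TopologicalSpace A₁] [DiscreteTopology A₁] [Finite A₁] {A₂ : Type u} [AddCommGroup A₂]
    [TopologicalSpace A₂] [DiscreteTopology A₂] [Finite A₂] (σ₁ : ContinuousRep G ℤ A₁)
    (σ₂ : ContinuousRep G ℤ A₂) (h₁ : ∀ (g : G) (a : A₁), σ₁ g a = a)
    (h₂ : ∀ (g : G) (a : A₂), σ₂ g a = a) {p : ℕ} [hp : Fact p.Prime] (hc₁ : Nat.card A₁ = p)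
    (hc₂ : Nat.card A₂ = p) (q : ℕ) :
    Nonempty ((continuousCohomology q σ₁.toTopRep : Type u) ≃+
      (continuousCohomology q σ₂.toTopRep : Type u)) := by
  have hcyc₁ : IsAddCyclic A₁ := isAddCyclic_of_prime_card hc₁
  have hcyc₂ : IsAddCyclic A₂ := isAddCyclic_of_prime_card hc₂
  let e : A₁ ≃+ A₂ := (zmodAddCyclicAddEquiv hcyc₁).symm.trans
    ((ZMod.ringEquivCongr (hc₁.trans hc₂.symm)).toAddEquiv.trans (zmodAddCyclicAddEquiv hcyc₂))
  let η : A₁ ≃ₜ+ A₂ :=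
    { e with
      continuous_toFun := continuous_of_discreteTopology
      continuous_invFun := continuous_of_discreteTopology }
  have hη : ∀ (g : G) (x : A₁), η (σ₁.toTopRep.ρ g x) = σ₂.toTopRep.ρ g (η x) := fun g x => by
    change η (σ₁ g x) = σ₂ g (η x)
    rw [h₁, h₂]
  exact ⟨continuousCohomologyAddEquiv (X := σ₁.toTopRep) (Y := σ₂.toTopRep) η hη q⟩

/-- `Finite` reading of `nonempty_continuousCohomology_addEquiv_of_trivial_of_card_eq`.
[cite: SerreGaloisCohomology1997, I §2.2] -/
theorem finite_continuousCohomology_of_trivial_of_card_eq {A₁ : Type u} [AddCommGroup A₁]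
    [TopologicalSpace A₁] [DiscreteTopology A₁] [Finite A₁] {A₂ : Type u} [AddCommGroup A₂]
    [TopologicalSpace A₂] [DiscreteTopology A₂] [Finite A₂] (σ₁ : ContinuousRep G ℤ A₁)
    (σ₂ : ContinuousRep G ℤ A₂) (h₁ : ∀ (g : G) (a : A₁), σ₁ g a = a)
    (h₂ : ∀ (g : G) (a : A₂), σ₂ g a = a) {p : ℕ} [Fact p.Prime] (hc₁ : Nat.card A₁ = p)
    (hc₂ : Nat.card A₂ = p) (q : ℕ) (hfin : Finite (continuousCohomology q σ₁.toTopRep)) :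
    Finite (continuousCohomology q σ₂.toTopRep) := by
  obtain ⟨e⟩ := nonempty_continuousCohomology_addEquiv_of_trivial_of_card_eq σ₁ σ₂ h₁ h₂ hc₁ hc₂ q
  exact Finite.of_equiv _ e.toEquiv

end Transport

/-! ## §3 Trivial coefficients: from the line `L` to every finite trivial `p`-primary module -/

section Algebra

/-- A submodule of a `p`-primary module is `p`-primary. [cite: SerreGaloisCohomology1997, II §3.1] -/
theorem isPrimaryTorsion_submodule {M : Type u} [AddCommGroup M] {p : ℕ} (hM : IsPrimaryTorsion p M)
    (W : Submodule ℤ M) : IsPrimaryTorsion p W := fun w => by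
  obtain ⟨r, hr⟩ := hM (w : M)
  exact ⟨r, Subtype.ext (by rw [Submodule.coe_smul_of_tower, Submodule.coe_zero]; exact hr)⟩

/-- A non-trivial `p`-primary module has non-zero `p`-torsion (a vector of order exactly `p`).
[cite: SerreGaloisCohomology1997, II §3.1] -/
theorem torsionBy_ne_bot_of_isPrimaryTorsion {M : Type u} [AddCommGroup M] [Nontrivial M] {p : ℕ}
    (hM : IsPrimaryTorsion p M) : Submodule.torsionBy ℤ M (p : ℤ) ≠ ⊥ := by
  classical
  obtain ⟨b, hb0⟩ := exists_ne (0 : M)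
  have hex : ∃ n : ℕ, p ^ n • b = 0 := hM b
  have hn₀ : p ^ Nat.find hex • b = 0 := Nat.find_spec hex
  have hn₀0 : Nat.find hex ≠ 0 := by
    intro h
    rw [h, pow_zero, one_smul] at hn₀
    exact hb0 hn₀
  obtain ⟨n₁, hn₁⟩ := Nat.exists_eq_succ_of_ne_zero hn₀0
  have hb₁0 : p ^ n₁ • b ≠ 0 := Nat.find_min hex (by omega)
  have hpb₁ : p • (p ^ n₁ • b) = 0 := by
    rw [← mul_smul, ← pow_succ', ← Nat.succ_eq_add_one, ← hn₁]
    exact hn₀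
  intro hbot
  have hmem : p ^ n₁ • b ∈ Submodule.torsionBy ℤ M (p : ℤ) := by
    rw [Submodule.mem_torsionBy_iff, Nat.cast_smul_eq_nsmul]
    exact hpb₁
  rw [hbot, Submodule.mem_bot] at hmem
  exact hb₁0 hmem

/-- The `p`-torsion submodule `M[p]` is stable under any linear action (a `private` copy of the
tree's `DualityLineTwo` lemma of the same name, to keep the imports light). [folklore] -/
private theorem torsionBy_le_comap_apply {G : Type u} [Group G] [TopologicalSpace G] {M : Type u} [AddCommGroup M]
    [TopologicalSpace M] (ρ : ContinuousRep G ℤ M) (p : ℕ) (g : G) :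
    Submodule.torsionBy ℤ M (p : ℤ) ≤ (Submodule.torsionBy ℤ M (p : ℤ)).comap (ρ g) := fun m hm => by
  rw [Submodule.mem_comap, Submodule.mem_torsionBy_iff]
  rw [Submodule.mem_torsionBy_iff] at hm
  rw [← map_smul, hm, map_zero]

end Algebra

section Trivial

variable {G : Type u} [Group G] [TopologicalSpace G] [IsTopologicalGroup G] [LocallyCompactSpace G]

/-- **Finite trivial `p`-primary coefficients.**  If `L` is a trivial discrete `G`-module of prime
order `p` with `H²(G, L)` finite, then `H²(G, W)` is finite for every finite discrete `p`-primary
`G`-module `W` with TRIVIAL action: induction on `#W` through a line `ℤ/p = ℤ w₁ ⊆ W` (any `w₁` of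
order `p`; `ℤ w₁ ≅ L` equivariantly) and `0 → ℤ w₁ → W → W/ℤ w₁ → 0` (`IsSES.finite_two_X₂`) —
Serre's "dévissage aux modules simples … isomorphes à `ℤ/pℤ`".
[cite: SerreGaloisCohomology1997, II §3.1 (proof of Prop. 5) and I §2.2]
[cite: NeukirchSchmidtWingberg2008, (8.3.20) (proof)] -/
theorem finite_continuousCohomology_two_of_trivial {p : ℕ} [hp : Fact p.Prime]
    {L : Type u} [AddCommGroup L] [TopologicalSpace L] [DiscreteTopology L] [Finite L]
    (σ₀ : ContinuousRep G ℤ L) (h₀ : ∀ (g : G) (v : L), σ₀ g v = v) (hL : Nat.card L = p)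
    (hfin : Finite (continuousCohomology 2 σ₀.toTopRep))
    (W : Type u) [AddCommGroup W] [TopologicalSpace W] [DiscreteTopology W] [Finite W]
    (τ : ContinuousRep G ℤ W) (htriv : ∀ (g : G) (w : W), τ g w = w) (hW : IsPrimaryTorsion p W) :
    Finite (continuousCohomology 2 τ.toTopRep) := by
  classical
  suffices key : ∀ (n : ℕ) (W : Type u) [AddCommGroup W] [TopologicalSpace W] [DiscreteTopology W]
      [Finite W] (τ : ContinuousRep G ℤ W), (∀ (g : G) (w : W), τ g w = w) →
      IsPrimaryTorsion p W → Nat.card W = n → Finite (continuousCohomology 2 τ.toTopRep) from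
    key _ W τ htriv hW rfl
  intro n
  induction n using Nat.strong_induction_on with
  | _ n ih =>
    intro W _ _ _ _ τ htriv hW hn
    by_cases hsub : Subsingleton W
    · haveI := subsingleton_continuousCohomology_of_subsingleton τ.toTopRep 1
      infer_instance
    · haveI : Nontrivial W := not_subsingleton_iff_nontrivial.1 hsub
      obtain ⟨b, hb0⟩ := exists_ne (0 : W)
      obtain ⟨b₁, hb₁0, hpb₁, hb₁fix⟩ := exists_line τ hW b hb0 fun g => htriv g b
      let W₁ : Submodule ℤ W := Submodule.span ℤ {b₁}
      have hW₁ : ∀ g, W₁ ≤ W₁.comap (τ g) := span_singleton_le_comap τ b₁ hb₁fix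
      have hSES := isSES_subtype_mkQ τ W₁ hW₁
      have hcardW : Nat.card W₁ = p := natCard_span_singleton b₁ hb₁0 hpb₁
      -- the line: `H²(G, ℤ b₁) ≅ H²(G, L)` is finite
      haveI h₁ : Finite (continuousCohomology 2 (τ.subrepresentation W₁ hW₁).toTopRep) :=
        finite_continuousCohomology_of_trivial_of_card_eq σ₀ (τ.subrepresentation W₁ hW₁) h₀
          (subrepresentation_span_apply τ b₁ hb₁fix) hL hcardW 2 hfin
      -- the quotient, by induction
      haveI : Finite (W ⧸ W₁) := Finite.of_surjective _ (Submodule.Quotient.mk_surjective W₁)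
      have hlt : Nat.card (W ⧸ W₁) < n := by
        have hmul : Nat.card W = Nat.card (W ⧸ W₁) * Nat.card W₁ :=
          AddSubgroup.card_eq_card_quotient_mul_card_addSubgroup W₁.toAddSubgroup
        rw [hn, hcardW] at hmul
        rw [hmul]
        exact (Nat.lt_mul_iff_one_lt_right Nat.card_pos).2 hp.out.one_lt
      have htriv' : ∀ (g : G) (x : W ⧸ W₁), τ.quotient W₁ hW₁ g x = x := fun g x => by
        induction x using Submodule.Quotient.induction_on with
        | _ m => rw [ContinuousRep.quotient_apply_mk, htriv g m]
      haveI h₃ : Finite (continuousCohomology 2 (τ.quotient W₁ hW₁).toTopRep) :=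
        ih _ hlt (W ⧸ W₁) (τ.quotient W₁ hW₁) htriv' (hW.quotient W₁) rfl
      exact hSES.finite_two_X₂

end Trivial

/-! ## §4 The dévissage -/

section Devissage

variable {G : Type u} [Group G] [TopologicalSpace G] [IsTopologicalGroup G] [CompactSpace G]
  [T2Space G] [TotallyDisconnectedSpace G]

/-- **Dévissage for `H²` of finite `p`-primary coefficients** (NSW (8.3.20), proof; Milne *ADT* I
Lemma 4.14 / proof of Thm. 1.8).  Let `G` be profinite, `ρ₀` a continuous action on a discrete `L`
of prime order `p`.  Suppose (i) `H¹(G, N)` is finite for every finite discrete `p`-primary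
`G`-module `N`, and (ii) `H²(U, L)` is finite for every open subgroup `U ≤ G` acting trivially on
`L`.  Then `H²(G, M)` is finite for every finite discrete `p`-primary `G`-module `M`.
Induction on `#M`: if `pM ≠ 0`, through `0 → M[p] → M → M/M[p] → 0` (`IsSES.finite_two_X₂`); if
`pM = 0`, through `0 → M → Maps(G ⧸ U, M) → Q → 0` with `U = ker ρ ∩ ker ρ₀` open
(`IsSES.finite_two_X₁`: `H¹(G, Q)` finite by (i); `H²(G, Maps(G ⧸ U, M)) ≅ H²(U, M)` by Shapiro,
`finite_continuousCohomology_coindOpen_iff`; and `M` is a TRIVIAL `U`-module, so §3 applies with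
the line `L|_U`, finite by (ii)). [cite: NeukirchSchmidtWingberg2008, (8.3.20) (proof)]
[cite: MilneADT2006, I Lemma 4.14 and I §1 (proof of Thm. 1.8)]
[cite: SerreGaloisCohomology1997, II §3.1 (proof of Prop. 5)] -/
theorem finite_continuousCohomology_two_of_isPrimaryTorsion {p : ℕ} [hp : Fact p.Prime]
    {L : Type u} [AddCommGroup L] [TopologicalSpace L] [DiscreteTopology L] [Finite L]
    (ρ₀ : ContinuousRep G ℤ L) (hL : Nat.card L = p)
    (h1 : ∀ (N : Type u) [AddCommGroup N] [TopologicalSpace N] [DiscreteTopology N] [Finite N]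
      (τ : ContinuousRep G ℤ N), IsPrimaryTorsion p N → Finite (continuousCohomology 1 τ.toTopRep))
    (h2 : ∀ (U : Subgroup G), IsOpen (U : Set G) → (∀ g ∈ U, ∀ v : L, ρ₀ g v = v) →
      Finite (continuousCohomology 2 (ρ₀.restrict (subgroupIncl U)).toTopRep))
    (M : Type u) [AddCommGroup M] [TopologicalSpace M] [DiscreteTopology M] [Finite M]
    (ρ : ContinuousRep G ℤ M) (hM : IsPrimaryTorsion p M) :
    Finite (continuousCohomology 2 ρ.toTopRep) := by
  classical
  suffices key : ∀ (n : ℕ) (M : Type u) [AddCommGroup M] [TopologicalSpace M] [DiscreteTopology M]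
      [Finite M] (ρ : ContinuousRep G ℤ M), IsPrimaryTorsion p M → Nat.card M = n →
      Finite (continuousCohomology 2 ρ.toTopRep) from key _ M ρ hM rfl
  intro n
  induction n using Nat.strong_induction_on with
  | _ n ih =>
    intro M _ _ _ _ ρ hM hn
    by_cases hsub : Subsingleton M
    · haveI := subsingleton_continuousCohomology_of_subsingleton ρ.toTopRep 1
      infer_instance
    haveI : Nontrivial M := not_subsingleton_iff_nontrivial.1 hsub
    let W : Submodule ℤ M := Submodule.torsionBy ℤ M (p : ℤ)
    have hW : ∀ g, W ≤ W.comap (ρ g) := torsionBy_le_comap_apply ρ p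
    by_cases htop : W = ⊤
    · /- `pM = 0`: embed `M` in `Maps(G ⧸ U, M)`, `U = ker ρ ⊓ ker ρ₀` -/
      have hpM : ∀ m : M, (p : ℤ) • m = 0 := fun m => by
        have hm : m ∈ W := by rw [htop]; exact Submodule.mem_top
        exact (Submodule.mem_torsionBy_iff _ _).1 hm
      let U : Subgroup G := ρ.ker ⊓ ρ₀.ker
      have hU : IsOpen (U : Set G) := by
        change IsOpen ((ρ.ker : Set G) ∩ (ρ₀.ker : Set G))
        exact (ρ.isOpen_ker_of_finite).inter ρ₀.isOpen_ker_of_finite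
      haveI : DiscreteTopology (G ⧸ U → M) := discreteTopology_coindOpen U hU
      have hSES := ρ.isSES_coindOpen U hU
      -- `H¹(G, Q)` finite
      haveI : Finite ((G ⧸ U → M) ⧸ ρ.coindOpenConst U hU) := ρ.finite_coindOpenQuot U hU
      haveI hQ : Finite (continuousCohomology 1 (ρ.coindOpenQuot U hU).toTopRep) :=
        h1 _ (ρ.coindOpenQuot U hU) (ρ.isPrimaryTorsion_coindOpenQuot U hU hM)
      -- `H²(G, Maps(G ⧸ U, M)) ≅ H²(U, M)` finite: `M` is a trivial `U`-module
      haveI : CompactSpace U :=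
        isCompact_iff_compactSpace.mp (Subgroup.isClosed_of_isOpen U hU).isCompact
      have hρU : ∀ (g : U) (m : M), ρ.restrict (subgroupIncl U) g m = m := fun g m => by
        rw [ContinuousRep.restrict_apply, subgroupIncl_apply]
        exact ρ.apply_eq_self_of_mem_ker g.2.1 m
      have hρ₀U : ∀ (g : U) (v : L), ρ₀.restrict (subgroupIncl U) g v = v := fun g v => by
        rw [ContinuousRep.restrict_apply, subgroupIncl_apply]
        exact ρ₀.apply_eq_self_of_mem_ker g.2.2 v
      have hfinU : Finite (continuousCohomology 2 (ρ.restrict (subgroupIncl U)).toTopRep) :=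
        finite_continuousCohomology_two_of_trivial (ρ₀.restrict (subgroupIncl U)) hρ₀U hL
          (h2 U hU fun g hg v => ρ₀.apply_eq_self_of_mem_ker hg.2 v) M
          (ρ.restrict (subgroupIncl U)) hρU hM
      haveI hC : Finite (continuousCohomology 2 (ρ.coindOpen U hU).toTopRep) :=
        (ρ.finite_continuousCohomology_coindOpen_iff U hU 2).2 hfinU
      exact hSES.finite_two_X₁
    · /- `pM ≠ 0`: `0 → M[p] → M → M/M[p] → 0`, both ends smaller -/
      have hbot : W ≠ ⊥ := torsionBy_ne_bot_of_isPrimaryTorsion hM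
      have hSES := isSES_subtype_mkQ ρ W hW
      haveI : Finite (M ⧸ W) := Finite.of_surjective _ (Submodule.Quotient.mk_surjective W)
      have hmul : Nat.card M = Nat.card (M ⧸ W) * Nat.card W :=
        AddSubgroup.card_eq_card_quotient_mul_card_addSubgroup W.toAddSubgroup
      have hW1 : 1 < Nat.card W := by
        rw [Finite.one_lt_card_iff_nontrivial]
        exact (Submodule.nontrivial_iff_ne_bot).2 hbot
      have hQ1 : 1 < Nat.card (M ⧸ W) := by
        rw [Finite.one_lt_card_iff_nontrivial]
        exact (Submodule.Quotient.nontrivial_iff (p := W)).2 htop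
      have hltW : Nat.card W < n := by
        rw [← hn, hmul]
        exact (Nat.lt_mul_iff_one_lt_left Nat.card_pos).2 hQ1
      have hltQ : Nat.card (M ⧸ W) < n := by
        rw [← hn, hmul]
        exact (Nat.lt_mul_iff_one_lt_right Nat.card_pos).2 hW1
      haveI h₁ : Finite (continuousCohomology 2 (ρ.subrepresentation W hW).toTopRep) :=
        ih _ hltW W (ρ.subrepresentation W hW) (isPrimaryTorsion_submodule hM W) rfl
      haveI h₃ : Finite (continuousCohomology 2 (ρ.quotient W hW).toTopRep) :=
        ih _ hltQ (M ⧸ W) (ρ.quotient W hW) (hM.quotient W) rfl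
      exact hSES.finite_two_X₂

end Devissage

end ContinuousRep

end Literature.NumberTheory.GaloisRepresentations

end
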